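import Mathlib
import HarnessLib
import Summits.Ventures.LatticeQCDFlow.Scoring.GlivenkoCantelli

/-!
# Sample QUANTILES (median, percentiles) of a printed statistic are strongly consistent at every
# identifiable level: a deterministic corollary of uniform convergence of distribution functions,
# then of the (reweighted) Glivenko–Cantelli theorem

HONEST FRAMING: exact (Metropolis-corrected) sampling algorithms for lattice gauge theory;
figures of merit are autocorrelation/cost numbers at stated couplings and volumes; no
continuum-physics claim.

Venture `LatticeQCDFlow` (cell pub-lqcd), topic `Scoring`; FANOUT row 4 (`s0-u1-b`, rung S0-B).
Sequel of `Scoring/GlivenkoCantelli` (imported): a flow card often prints the MEDIAN or a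
percentile of a continuous statistic (of the reweighted sample) rather than its full distribution
function.  If `Fₙ` are monotone and `Fₙ → F = cdf ρ` UNIFORMLY, then at every level `u ∈ (0,1)`
at which the quantile `q(u) = inf {x : u ≤ F(x)}` is IDENTIFIABLE — `F(q(u) + ε) > u` for every
`ε > 0` (no flat stretch of `F` at height `u` to the right of `q(u)`) — the plug-in quantiles
`q̂ₙ(u) = inf {x : u ≤ Fₙ(x)}` converge to `q(u)` (**`tendsto_sampleQuantile_of_tendstoUniformly`**;
van der Vaart, *Asymptotic Statistics* (1998) Lemma 21.2, NAMED ONLY).  Fed with row 4's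
Glivenko–Cantelli theorems this gives almost-sure consistency of the classical sample quantiles
(**`sampleQuantile_tendsto_ae`**) and of the printed REWEIGHTED sample quantiles of a statistic
along one proposal stream (**`reweightedSampleQuantile_tendsto_ae`**), with no moment hypothesis.
NEW WORK of the cell (our formalisation); no definition is introduced.

## Content (`F = cdf ρ`, `q(u) = sInf {x | u ≤ F x}`, `q̂ₙ(u) = sInf {x | u ≤ Fₙ x}`)

* **`tendsto_sampleQuantile_of_tendstoUniformly`** — deterministic;
* **`sampleQuantile_tendsto_ae`** — i.i.d. (pairwise independent) real sequence;
* **`reweightedSampleQuantile_tendsto_ae`** — the printed reweighted quantile of `O` along the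
  stream (`p ≥ 0`, `∫ p = 1`, `q > 0`, `c > 0`).

NOT CLAIMED: non-identifiable levels (the set of limit points is then the flat interval); a rate
or a Bahadur representation; any number of ours re-scored.
-/

noncomputable section

namespace Summit.Ventures.LatticeQCDFlow.Scoring.GlivenkoCantelli

open MeasureTheory ProbabilityTheory Finset Filter Function
open scoped Topology

/-! ## §1 Deterministic: uniform convergence of distribution functions ⇒ quantile convergence -/

section Deterministic

variable (ρ : Measure ℝ) {F : ℕ → ℝ → ℝ}

/-- **QUANTILES FOLLOW UNIFORMLY CONVERGENT DISTRIBUTION FUNCTIONS.**  `Fₙ` monotone,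
`Fₙ → F = cdf ρ` uniformly on `ℝ`, `u ∈ (0,1)` with `F(q(u) + ε) > u` for every `ε > 0`
(`q(u) = inf {x : u ≤ F(x)}`).  Then `inf {x : u ≤ Fₙ(x)} → q(u)`. [ours] (our formalisation of
van der Vaart's Lemma 21.2, uniform-convergence form) -/
theorem tendsto_sampleQuantile_of_tendstoUniformly (hmono : ∀ n, Monotone (F n))
    (hF : TendstoUniformly F (cdf ρ) atTop) {u : ℝ} (hu0 : 0 < u) (hu1 : u < 1)
    (hid : ∀ ε, 0 < ε → u < cdf ρ (sInf {x | u ≤ cdf ρ x} + ε)) :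
    Tendsto (fun n => sInf {x | u ≤ F n x}) atTop (𝓝 (sInf {x | u ≤ cdf ρ x})) := by
  set q : ℝ := sInf {x | u ≤ cdf ρ x} with hq
  obtain ⟨-, -, hgal⟩ := cdf_quantile_spec ρ hu0 hu1
  rw [Metric.tendsto_atTop]
  intro ε' hε'
  -- work at radius `ε = ε'/2` to get a strict final inequality
  set ε : ℝ := ε' / 2 with hεdef
  have hε : 0 < ε := by positivity
  -- margins: `F(q + ε) > u` (identifiability), `F(q − ε) < u` (Galois property of the quantile)
  have hup : u < cdf ρ (q + ε) := hid ε hε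
  have hdown : cdf ρ (q - ε) < u := by
    by_contra h
    have h' : q ≤ q - ε := (hgal (q - ε)).2 (not_lt.1 h)
    linarith
  obtain ⟨δ, hδ0, hδ1, hδ2⟩ : ∃ δ, 0 < δ ∧ u + δ < cdf ρ (q + ε) ∧ cdf ρ (q - ε) < u - δ :=
    ⟨min ((cdf ρ (q + ε) - u) / 2) ((u - cdf ρ (q - ε)) / 2),
      lt_min (by linarith) (by linarith),
      by linarith [min_le_left ((cdf ρ (q + ε) - u) / 2) ((u - cdf ρ (q - ε)) / 2)],
      by linarith [min_le_right ((cdf ρ (q + ε) - u) / 2) ((u - cdf ρ (q - ε)) / 2)]⟩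
  obtain ⟨N, hN⟩ := eventually_atTop.1 ((Metric.tendstoUniformly_iff.1 hF) δ hδ0)
  refine ⟨N, fun n hn => ?_⟩
  have hdev : ∀ x, |cdf ρ x - F n x| < δ := fun x => by
    have h := hN n hn x
    rwa [Real.dist_eq] at h
  -- `q + ε` is admissible for `Fₙ`; nothing `≤ q − ε` is
  have hmem : u ≤ F n (q + ε) := by
    have h := hdev (q + ε)
    rw [abs_sub_lt_iff] at h
    linarith [h.1]
  have hlow : ∀ x, u ≤ F n x → q - ε < x := by
    intro x hx
    by_contra hle
    have h1 : F n x ≤ F n (q - ε) := hmono n (not_lt.1 hle)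
    have h2 := hdev (q - ε)
    rw [abs_sub_lt_iff] at h2
    linarith [h2.2]
  have hbdd : BddBelow {x | u ≤ F n x} := ⟨q - ε, fun x hx => (hlow x hx).le⟩
  have hne : {x | u ≤ F n x}.Nonempty := ⟨q + ε, hmem⟩
  have habove : sInf {x | u ≤ F n x} ≤ q + ε := csInf_le hbdd hmem
  have hbelow : q - ε ≤ sInf {x | u ≤ F n x} := le_csInf hne fun x hx => (hlow x hx).le
  rw [Real.dist_eq, abs_sub_lt_iff]
  constructor <;> linarith

end Deterministic

/-! ## §2 Almost-sure consistency of sample quantiles -/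

section Classical

variable {Ω : Type*} [MeasurableSpace Ω] {P : Measure Ω} [IsProbabilityMeasure P] {X : ℕ → Ω → ℝ}

/-- **Sample quantiles of an i.i.d. (pairwise independent) real sequence are strongly consistent
at every identifiable level**: with `F = cdf ρ`, `ρ` the common law and `u ∈ (0,1)` such that
`F(q(u) + ε) > u` for all `ε > 0`, almost surely the empirical `u`-quantile
`inf {x : #{i<n : Xᵢ ≤ x}/n ≥ u}` tends to `q(u) = inf {x : F(x) ≥ u}`. [ours] -/
theorem sampleQuantile_tendsto_ae (hind : Pairwise ((· ⟂ᵢ[P] ·) on X))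
    (hid : ∀ i, IdentDistrib (X i) (X 0) P P) {u : ℝ} (hu0 : 0 < u) (hu1 : u < 1)
    (hq : ∀ ε, 0 < ε →
      u < cdf (P.map (X 0)) (sInf {x | u ≤ cdf (P.map (X 0)) x} + ε)) :
    ∀ᵐ ω ∂P, Tendsto (fun n : ℕ =>
        sInf {x | u ≤ (∑ i ∈ range n, (Set.Iic x).indicator (1 : ℝ → ℝ) (X i ω)) / n}) atTop
      (𝓝 (sInf {x | u ≤ cdf (P.map (X 0)) x})) := by
  filter_upwards [glivenkoCantelli_ae hind hid] with ω hω
  have hmono : ∀ n : ℕ, Monotone fun x : ℝ =>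
      (∑ i ∈ range n, (Set.Iic x).indicator (1 : ℝ → ℝ) (X i ω)) / (n : ℝ) := fun n s t hst =>
    div_le_div_of_nonneg_right (sum_le_sum fun i _ => indicator_Iic_mono _ hst) (Nat.cast_nonneg n)
  exact tendsto_sampleQuantile_of_tendstoUniformly (P.map (X 0)) hmono hω hu0 hu1 hq

end Classical

section Reweighted

variable {Ω : Type*} [MeasurableSpace Ω] {P : Measure Ω}
variable {X : Type*} [MeasurableSpace X] {μ : Measure X} {p q O : X → ℝ} {y : ℕ → Ω → X}

/-- **The printed reweighted sample quantiles of a statistic are strongly consistent at every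
identifiable level.**  One independent proposal stream `yᵢ` (laws `μ.withDensity q`); target
`p ≥ 0` measurable, integrable, `∫ p dμ = 1`; `q > 0` measurable; `O` a measurable real
statistic with target law `ρ = (p dμ) ∘ O⁻¹`, `F = cdf ρ`; weights `w̃ = c·p/q`, `c > 0`.  At a
level `u ∈ (0,1)` with `F(q(u) + ε) > u` for all `ε > 0`, almost surely the printed quantile
`inf {x : Σ_{i<n} w̃ᵢ·1{O(yᵢ) ≤ x}/Σ_{i<n} w̃ᵢ ≥ u}` (e.g. the reweighted median, `u = ½`) tends to
the target quantile `q(u)`; no moment hypothesis. [ours] -/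
theorem reweightedSampleQuantile_tendsto_ae (hym : ∀ j, Measurable (y j)) (hind : iIndepFun y P)
    (hlaw : ∀ j, Measure.map (y j) P = μ.withDensity fun z => ENNReal.ofReal (q z))
    (hp0 : ∀ z, 0 ≤ p z) (hpm : Measurable p) (hpi : Integrable p μ) (hp1 : ∫ z, p z ∂μ = 1)
    (hq0 : ∀ z, 0 < q z) (hqm : Measurable q) (hOm : Measurable O) {wt : X → ℝ} {c : ℝ}
    (hc : 0 < c) (hwt : ∀ z, wt z = c * (p z / q z)) {u : ℝ} (hu0 : 0 < u) (hu1 : u < 1)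
    (hq : ∀ ε, 0 < ε → u < cdf ((μ.withDensity fun z => ENNReal.ofReal (p z)).map O)
      (sInf {x | u ≤ cdf ((μ.withDensity fun z => ENNReal.ofReal (p z)).map O) x} + ε)) :
    ∀ᵐ ω ∂P, Tendsto (fun n : ℕ => sInf {x | u ≤
        (∑ i ∈ range n, wt (y i ω) * (Set.Iic x).indicator (1 : ℝ → ℝ) (O (y i ω)))
          / (∑ i ∈ range n, wt (y i ω))}) atTop
      (𝓝 (sInf {x | u ≤ cdf ((μ.withDensity fun z => ENNReal.ofReal (p z)).map O) x})) := by
  have hwt0 : ∀ z, 0 ≤ wt z := fun z => by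
    rw [hwt]
    exact mul_nonneg hc.le (div_nonneg (hp0 z) (hq0 z).le)
  filter_upwards [reweightedGlivenkoCantelli_ae hym hind hlaw hp0 hpm hpi hp1 hq0 hqm hOm hc hwt]
    with ω hω
  have hmono : ∀ n : ℕ, Monotone fun x : ℝ =>
      (∑ i ∈ range n, wt (y i ω) * (Set.Iic x).indicator (1 : ℝ → ℝ) (O (y i ω)))
        / (∑ i ∈ range n, wt (y i ω)) := fun n s t hst =>
    div_le_div_of_nonneg_right
      (sum_le_sum fun i _ => mul_le_mul_of_nonneg_left (indicator_Iic_mono _ hst) (hwt0 _))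
      (sum_nonneg fun i _ => hwt0 _)
  exact tendsto_sampleQuantile_of_tendstoUniformly _ hmono hω hu0 hu1 hq

end Reweighted


end Summit.Ventures.LatticeQCDFlow.Scoring.GlivenkoCantelli

end
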